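import Summits.BirchSwinnertonDyer.Rank1Residual.AdditivePotMult.RamifiedOrdinaryLinePotMult
import HarnessLib

/-!
# LINE-MATCHING IS AUTOMATIC on (M)–(M) pairs: every Γ_ℚ-equivariant `E[p] ≃ E₁[p]` between two
# potentially multiplicative curves at the same odd `p` carries the ramified ordinary line of one onto
# that of the other (cell `b2b-bsdres`, team n1011, seat p07 (gen 4), row TB-ROL FILE C; sequel of
# `AdditivePotMult/RamifiedOrdinaryLinePotMult.lean`)

HONEST FRAMING (cell `b2b-bsdres`, run/shared/lean/b2b/bsd-rank1-residual/, verbatim in every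
file): the goal of the cell is to DELETE the COMBINATION-SHAPED residual classes of the
Birch–Swinnerton-Dyer formula for ALL analytic-rank `≤ 1` elliptic curves over `ℚ` — "full BSD
formula for every rank `≤ 1` curve in class `C`" assembled STRICTLY from published theorems — so
that the rank-`≤ 1` remainder becomes exactly the CONSTRUCTION-SHAPED classes, which are TYPED
(missing-input `Prop`s), NOT attempted. This is not "finishing BSD". Team n1011 (RESIDUAL-MAP §I
N10 / N11 LOWER on the (M) rows; Route G's (M) EPW consumer
`AdditivePotMult/PotMultCongruentPartnerEPW`): research route; labels and marks UNCHANGED; nothing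
booked. Theorems only; NO definition; NO new named fact. §2–§3 are CONDITIONAL on the tree's EXISTING
named facts A40/A41 (Silverman *ATAEC* V.3.1 / V.5.3 / V.5.4, hypotheses `hT40`, `hT41`); §1 is
unconditional algebra.

## What and why

The EPW transfer (`EmertonPollackWeston2006.muLambdaAlg_transfer_of_torsionIso_potOrd`) is stated for
a congruence `e : E[p] ≃ E₁[p]` that RESPECTS the ramified ordinary lines ("two members of the same
Hida family with the SAME `p`-stabilisation", EPW pp. 2–3): `P ∈ C[p] ↔ eP ∈ C₁[p]`. On the rows
where the lines are built by `RamifiedOrdinaryLinePotMult` (the Tate line of the multiplicative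
`p*`-twist model, transported) this clause is AUTOMATIC, because the lines carry an inertia
signature that any `Γ_ℚ`-equivariant map must preserve: choose ONE local inertia element `σ₁` with
`χ_p(σ₁) = 2` (`exists_mem_absInertia_cyclotomicCharacter_eq_natCast`; `p` odd) and let
`ε = χ_{p*}(res σ₁) ∈ {±1}` (the sign of the twist transport at `res σ₁`, the SAME for both curves);
then `res σ₁` acts on `C[p]` and on `C₁[p]` as `2ε` (LINE SHAPE: `C[p] ≅ μ_p ⊗ χ_{p*}`) and on
`E[p^∞]/C`, `E₁[p^∞]/C₁` as `ε` (QUOTIENT SHAPE: `D ⊗ χ_{p*}`, `D` unramified). For `P ∈ C[p]`: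
`res σ₁ • eP = e(res σ₁ • P) = 2ε • eP`, and `res σ₁ • eP − ε • eP ∈ C₁`, so `ε • eP ∈ C₁`, `eP ∈ C₁`
(§1, pure algebra on `E[p] ↪ E[p^∞]`); symmetrically with `e⁻¹`. Hence (§2–§3): for two ramified
`c`-twists of multiplicative curves (`C • V^{(c)} = W`, `C₁ • V₁^{(c)} = W₁`, `ord_p c = 1`), in
particular for ANY two potentially multiplicative pairs `(E,p)`, `(E₁,p)` at the same odd `p`
(`PotMult.exists_lines_matching`), there are ramified ordinary lines `L`, `L₁`
(`IsRamifiedOrdinaryLine`) such that EVERY `Γ_ℚ`-equivariant `E[p] ≃+ E₁[p]` satisfies the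
line-respecting clause — the hypothesis `hiso` of the EPW consumers follows from a PLAIN congruence
(the census's `TorsionIso` currency). The consumer swap is the sequel
`AdditivePotMult/PotMultCongruentPartnerEPWLines.lean`.

References: M. Emerton, R. Pollack, T. Weston, Invent. Math. 163 (2006) pp. 2–3, §3.1;
R. Greenberg, V. Vatsal, Invent. Math. 142 (2000) §2 pp. 14–15; J. H. Silverman, *ATAEC* V.5.3–5.4;
J.-P. Serre, *Local Fields* IV §4 Prop. 17 (the cyclotomic character on inertia).
-/

noncomputable section

open scoped Classical NumberField AddSubgroup

universe u

namespace Summit.BirchSwinnertonDyer.Rank1Residual.AdditivePotMult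

open NumberField IsDedekindDomain Field WeierstrassCurve
  Literature.NumberTheory.EllipticCurves
  Literature.NumberTheory.EllipticCurves.GreenbergSelmer
  Literature.NumberTheory.EllipticCurves.EmertonPollackWeston2006
  Literature.NumberTheory.GaloisRepresentations
  Literature.NumberTheory.EllipticCurves.Rank1Residual
  Summit.BirchSwinnertonDyer.Rank1Residual.X2
  Summit.BirchSwinnertonDyer.Rank1Residual.X2.GreenbergVatsalTateDatumTorsion
  Summit.BirchSwinnertonDyer.Rank1Residual.GaloisImage.RamifiedOrdinaryLineTwist

namespace RamifiedOrdinaryLineMatching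

/-! ### §1 Line shape at `W` + quotient shape at `W₁` at ONE common inertia element force matching -/

section Generic

variable {W W₁ : WeierstrassCurve ℚ} {p : ℕ} [hp : Fact p.Prime] {v : HeightOneSpectrum (𝓞 ℚ)}
  (L : LocalDatum ℚ (W.geomPrimaryTorsion p) v) (L₁ : LocalDatum ℚ (W₁.geomPrimaryTorsion p) v)
  (e : geomTorsion W (p : ℤ) ≃+ geomTorsion W₁ (p : ℤ))
  (he : ∀ (σ : absoluteGaloisGroup ℚ) (P : geomTorsion W (p : ℤ)), e (σ • P) = σ • e P)

omit hp in
/-- The inclusion `E[p] ↪ E[p^∞]` of a `p`-torsion point is killed by `p`. [folklore] -/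
theorem nsmul_inclusion_eq_zero (P : geomTorsion W (p : ℤ)) :
    p • AddSubgroup.inclusion (geomTorsion_le_geomPrimaryTorsion W p) P = 0 :=
  Subtype.ext (by
    rw [AddSubmonoidClass.coe_nsmul, ZeroMemClass.coe_zero]
    exact AddSubgroup.torsionBy.nsmul_iff.mp P.2)

omit hp in
include he in
/-- A `Γ_ℚ`-equivariant isomorphism `E[p] ≃ E₁[p]` has a `Γ_ℚ`-equivariant inverse. [folklore] -/
theorem symm_smul (σ : absoluteGaloisGroup ℚ) (Q : geomTorsion W₁ (p : ℤ)) :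
    e.symm (σ • Q) = σ • e.symm Q :=
  e.injective (by rw [e.apply_symm_apply, he, e.apply_symm_apply])

omit hp in
include he in
/-- **Matching, `+` branch.** If one `g ∈ Γ_ℚ` acts on `C ∩ W[p]` as multiplication by `2`
(LINE SHAPE at `W`) and trivially on `W₁[p^∞]/C₁` (QUOTIENT SHAPE at `W₁`), then every
`Γ_ℚ`-equivariant `e : W[p] ≃ W₁[p]` maps `C ∩ W[p]` INTO `C₁`: for `P ∈ C[p]`,
`g • eP = e(gP) = 2 • eP` and `g • eP − eP ∈ C₁`, so `eP ∈ C₁`. (EPW p. 3: the congruence "respects the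
`p`-stabilisations" — here automatically.) [cite: EmertonPollackWeston2006, pp. 2–3 and §3.1 (eq:ordes) (arXiv:math/0404484 p. 17)] -/
theorem inclusion_apply_mem_of_pos {g : absoluteGaloisGroup ℚ}
    (hline : ∀ m ∈ L.plus, p • m = 0 → g • m = (2 : ℕ) • m)
    (hquot₁ : ∀ x : W₁.geomPrimaryTorsion p, g • x - x ∈ L₁.plus)
    (P : geomTorsion W (p : ℤ))
    (hP : AddSubgroup.inclusion (geomTorsion_le_geomPrimaryTorsion W p) P ∈ L.plus) :
    AddSubgroup.inclusion (geomTorsion_le_geomPrimaryTorsion W₁ p) (e P) ∈ L₁.plus := by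
  have h1 := hline _ hP (nsmul_inclusion_eq_zero P)
  have h2 : g • P = (2 : ℕ) • P :=
    Subtype.ext (by
      have h := congrArg Subtype.val h1
      simpa only [primaryComponent.coe_smul, AddSubmonoidClass.coe_nsmul, AddSubgroup.coe_inclusion,
        AddSubgroup.torsionBy.coe_smul] using h)
  have h3 : g • e P = (2 : ℕ) • e P := by rw [← he, h2, map_nsmul]
  have h4 : g • AddSubgroup.inclusion (geomTorsion_le_geomPrimaryTorsion W₁ p) (e P) =
      (2 : ℕ) • AddSubgroup.inclusion (geomTorsion_le_geomPrimaryTorsion W₁ p) (e P) := by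
    rw [← TateLineDecomposition.inclusion_smul, h3, map_nsmul]
  have h5 := hquot₁ (AddSubgroup.inclusion (geomTorsion_le_geomPrimaryTorsion W₁ p) (e P))
  rwa [h4, two_nsmul, add_sub_cancel_right] at h5

omit hp in
include he in
/-- **Matching, `−` branch.** If `g` acts on `C ∩ W[p]` as `−2` and as `−1` on `W₁[p^∞]/C₁`, then
every `Γ_ℚ`-equivariant `e : W[p] ≃ W₁[p]` maps `C ∩ W[p]` into `C₁`.
[cite: EmertonPollackWeston2006, pp. 2–3 and §3.1 (eq:ordes) (arXiv:math/0404484 p. 17)] -/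
theorem inclusion_apply_mem_of_neg {g : absoluteGaloisGroup ℚ}
    (hline : ∀ m ∈ L.plus, p • m = 0 → g • m = -((2 : ℕ) • m))
    (hquot₁ : ∀ x : W₁.geomPrimaryTorsion p, g • x + x ∈ L₁.plus)
    (P : geomTorsion W (p : ℤ))
    (hP : AddSubgroup.inclusion (geomTorsion_le_geomPrimaryTorsion W p) P ∈ L.plus) :
    AddSubgroup.inclusion (geomTorsion_le_geomPrimaryTorsion W₁ p) (e P) ∈ L₁.plus := by
  have h1 := hline _ hP (nsmul_inclusion_eq_zero P)
  have h2 : g • P = -((2 : ℕ) • P) :=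
    Subtype.ext (by
      have h := congrArg Subtype.val h1
      simpa only [primaryComponent.coe_smul, AddSubmonoidClass.coe_nsmul, NegMemClass.coe_neg,
        AddSubgroup.coe_inclusion, AddSubgroup.torsionBy.coe_smul] using h)
  have h3 : g • e P = -((2 : ℕ) • e P) := by rw [← he, h2, map_neg, map_nsmul]
  have h4 : g • AddSubgroup.inclusion (geomTorsion_le_geomPrimaryTorsion W₁ p) (e P) =
      -((2 : ℕ) • AddSubgroup.inclusion (geomTorsion_le_geomPrimaryTorsion W₁ p) (e P)) := by
    rw [← TateLineDecomposition.inclusion_smul, h3, map_neg, map_nsmul]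
  have h5 := hquot₁ (AddSubgroup.inclusion (geomTorsion_le_geomPrimaryTorsion W₁ p) (e P))
  have h6 : -((2 : ℕ) • AddSubgroup.inclusion (geomTorsion_le_geomPrimaryTorsion W₁ p) (e P)) +
      AddSubgroup.inclusion (geomTorsion_le_geomPrimaryTorsion W₁ p) (e P) =
      -AddSubgroup.inclusion (geomTorsion_le_geomPrimaryTorsion W₁ p) (e P) := by
    rw [two_nsmul]; abel
  rw [h4, h6, neg_mem_iff] at h5
  exact h5

omit hp in
include he in
/-- **Matching in both directions** (the `+`/`−` branch chosen by the SAME `g` on both curves): LINE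
and QUOTIENT shape at `W` and at `W₁` for one `g` ⟹ `P ∈ C ↔ eP ∈ C₁` for every `Γ_ℚ`-equivariant
`e : W[p] ≃ W₁[p]` — the line-respecting clause of the EPW transfer's congruence hypothesis.
[cite: EmertonPollackWeston2006, pp. 2–3 and §3.1 (eq:ordes) (arXiv:math/0404484 p. 17)] -/
theorem inclusion_mem_iff_of_shape {g : absoluteGaloisGroup ℚ}
    (hshape : ((∀ m ∈ L.plus, p • m = 0 → g • m = (2 : ℕ) • m) ∧
        (∀ x : W.geomPrimaryTorsion p, g • x - x ∈ L.plus) ∧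
        (∀ m ∈ L₁.plus, p • m = 0 → g • m = (2 : ℕ) • m) ∧
        (∀ x : W₁.geomPrimaryTorsion p, g • x - x ∈ L₁.plus)) ∨
      ((∀ m ∈ L.plus, p • m = 0 → g • m = -((2 : ℕ) • m)) ∧
        (∀ x : W.geomPrimaryTorsion p, g • x + x ∈ L.plus) ∧
        (∀ m ∈ L₁.plus, p • m = 0 → g • m = -((2 : ℕ) • m)) ∧
        (∀ x : W₁.geomPrimaryTorsion p, g • x + x ∈ L₁.plus)))
    (P : geomTorsion W (p : ℤ)) :
    AddSubgroup.inclusion (geomTorsion_le_geomPrimaryTorsion W p) P ∈ L.plus ↔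
      AddSubgroup.inclusion (geomTorsion_le_geomPrimaryTorsion W₁ p) (e P) ∈ L₁.plus := by
  rcases hshape with ⟨hl, hq, hl₁, hq₁⟩ | ⟨hl, hq, hl₁, hq₁⟩
  · refine ⟨inclusion_apply_mem_of_pos L L₁ e he hl hq₁ P, fun h ↦ ?_⟩
    have h' := inclusion_apply_mem_of_pos L₁ L e.symm (symm_smul e he) hl₁ hq (e P) h
    rwa [e.symm_apply_apply] at h'
  · refine ⟨inclusion_apply_mem_of_neg L L₁ e he hl hq₁ P, fun h ↦ ?_⟩
    have h' := inclusion_apply_mem_of_neg L₁ L e.symm (symm_smul e he) hl₁ hq (e P) h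
    rwa [e.symm_apply_apply] at h'

end Generic

/-! ### §2 Two (M) twists at the same odd `p`: their ramified ordinary lines match under ANY congruence -/

section Pair

variable (V V₁ : WeierstrassCurve ℚ) [V.IsGloballyMinimal] [V.IsElliptic] [V₁.IsGloballyMinimal]
  [V₁.IsElliptic] (K : Type) [Field K] [NumberField K] (h2 : Module.finrank ℚ K = 2) {θ : K} {c : ℚ}
  (hθ : θ ∉ Set.range (algebraMap ℚ K)) (hc : θ ^ 2 = algebraMap ℚ K c) (p : ℕ) [hp : Fact p.Prime]
  {W W₁ : WeierstrassCurve ℚ} {C C₁ : VariableChange ℚ} (hC : C • V.quadraticTwist c = W)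
  (hC₁ : C₁ • V₁.quadraticTwist c = W₁)

include h2 hθ hc hC hC₁ in
/-- **The ramified ordinary lines of two ramified `c`-twists of multiplicative curves MATCH under every
`Γ_ℚ`-equivariant `W[p] ≃ W₁[p]`** (mod A40/A41): with `L`, `L₁` the transported Tate lines of
`RamifiedOrdinaryLinePotMult.exists_isRamifiedOrdinaryLine_shape_of_mult_twist` and `σ₁` a local
inertia element with `χ_p(σ₁) = 2` (`exists_mem_absInertia_cyclotomicCharacter_eq_natCast`, `p` odd),
`res σ₁` acts on both `C[p]`, `C₁[p]` as `±2` and on both quotients as `±1` — the SAME sign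
`χ_c(res σ₁)` — so §1 applies. Hence for such a pair the "same `p`-stabilisation" clause of the
EPW congruence hypothesis is AUTOMATIC. [cite: EmertonPollackWeston2006, pp. 2–3 and §3.1 (eq:ordes) (arXiv:math/0404484 p. 17)]
[cite: GreenbergVatsal2000, §2 pp. 14–15] [cite: SilvermanATAEC1994, Ch. V Thm. 5.3, Cor. 5.4] -/
theorem exists_lines_matching_of_mult_twists
    (hT40 : Silverman1994_thmV53_tateUniformisation.{0})
    (hT41 : Silverman1994_thmV53_corV54_tateUniformisation.{0}) (hp2 : p ≠ 2)
    (hmult : V.HasMultiplicativeReductionAtPrime p) (hmult₁ : V₁.HasMultiplicativeReductionAtPrime p)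
    {v : HeightOneSpectrum (𝓞 ℚ)} (hv : ((p : ℕ) : 𝓞 ℚ) ∈ v.asIdeal)
    (hval : v.valuation ℚ c = WithZero.exp (-1 : ℤ)) :
    ∃ (L : LocalDatum ℚ (W.geomPrimaryTorsion p) v) (L₁ : LocalDatum ℚ (W₁.geomPrimaryTorsion p) v),
      IsRamifiedOrdinaryLine W p L ∧ IsRamifiedOrdinaryLine W₁ p L₁ ∧
      ∀ e : geomTorsion W (p : ℤ) ≃+ geomTorsion W₁ (p : ℤ),
        (∀ (σ : absoluteGaloisGroup ℚ) (P : geomTorsion W (p : ℤ)), e (σ • P) = σ • e P) →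
        ∀ P : geomTorsion W (p : ℤ),
          AddSubgroup.inclusion (geomTorsion_le_geomPrimaryTorsion W p) P ∈ L.plus ↔
            AddSubgroup.inclusion (geomTorsion_le_geomPrimaryTorsion W₁ p) (e P) ∈ L₁.plus := by
  obtain ⟨L, hL, hqL, hlL⟩ := RamifiedOrdinaryLinePotMult.exists_isRamifiedOrdinaryLine_shape_of_mult_twist
    V K h2 hθ hc p hC hT40 hT41 hp2 hmult hv hval
  obtain ⟨L₁, hL₁, hqL₁, hlL₁⟩ :=
    RamifiedOrdinaryLinePotMult.exists_isRamifiedOrdinaryLine_shape_of_mult_twist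
      V₁ K h2 hθ hc p hC₁ hT40 hT41 hp2 hmult₁ hv hval
  have hpp : 2 < p := lt_of_le_of_ne hp.out.two_le (Ne.symm hp2)
  obtain ⟨σ₁, hσ₁, hχ⟩ := exists_mem_absInertia_cyclotomicCharacter_eq_natCast p hv (N := 2)
    (fun h ↦ hp2 ((Nat.prime_dvd_prime_iff_eq hp.out Nat.prime_two).mp h))
  refine ⟨L, L₁, hL, hL₁, fun e he P ↦
    inclusion_mem_iff_of_shape L L₁ e he (g := absGaloisRestrict ℚ (v.adicCompletion ℚ) σ₁) ?_ P⟩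
  by_cases hg : absGaloisRestrict ℚ (v.adicCompletion ℚ) σ₁ ∈ galRange (K := ℚ) K
  · exact Or.inl ⟨fun m hm hpm ↦ ((hlL σ₁ hσ₁ 2 hpp hχ m hm hpm).1 hg), (hqL σ₁ hσ₁).1 hg,
      fun m hm hpm ↦ ((hlL₁ σ₁ hσ₁ 2 hpp hχ m hm hpm).1 hg), (hqL₁ σ₁ hσ₁).1 hg⟩
  · exact Or.inr ⟨fun m hm hpm ↦ ((hlL σ₁ hσ₁ 2 hpp hχ m hm hpm).2 hg), (hqL σ₁ hσ₁).2 hg,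
      fun m hm hpm ↦ ((hlL₁ σ₁ hσ₁ 2 hpp hχ m hm hpm).2 hg), (hqL₁ σ₁ hσ₁).2 hg⟩

end Pair

end RamifiedOrdinaryLineMatching

/-! ### §3 The (M) classes: on every (M)–(M) pair at odd `p`, a plain congruence `E[p] ≅ E₁[p]` respects the lines -/

section Classes

open RamifiedOrdinaryLineMatching

variable {W W₁ : WeierstrassCurve ℚ} [W.IsElliptic] [W₁.IsElliptic] {p : ℕ} [hp : Fact p.Prime]

/-- **pot-mult(p) × pot-mult(p), odd `p` (`p = 3` included): ramified ordinary lines that match under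
every congruence.** For `E`, `E₁` both potentially multiplicative at `p` (their `p*`-twist models are
multiplicative: `PotMult.exists_mult_pStar_twist_model`), mod A40/A41: there are ramified ordinary
lines `L` at `E` and `L₁` at `E₁` such that EVERY `Γ_ℚ`-equivariant `E[p] ≃+ E₁[p]` carries `L[p]` onto
`L₁[p]` — exactly the hypothesis `hiso` of the EPW consumers, from a PLAIN congruence.
[cite: EmertonPollackWeston2006, pp. 2–3 and §3.1 (eq:ordes) (arXiv:math/0404484 p. 17)] [cite: SilvermanATAEC1994, Ch. V Thm. 5.3, Cor. 5.4] -/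
theorem PotMult.exists_lines_matching (hT40 : Silverman1994_thmV53_tateUniformisation.{0})
    (hT41 : Silverman1994_thmV53_corV54_tateUniformisation.{0}) (hpm : PotMult W p)
    (hpm₁ : PotMult W₁ p) (hp2 : p ≠ 2) {v : HeightOneSpectrum (𝓞 ℚ)}
    (hv : ((p : ℕ) : 𝓞 ℚ) ∈ v.asIdeal) :
    ∃ (L : LocalDatum ℚ (W.geomPrimaryTorsion p) v) (L₁ : LocalDatum ℚ (W₁.geomPrimaryTorsion p) v),
      IsRamifiedOrdinaryLine W p L ∧ IsRamifiedOrdinaryLine W₁ p L₁ ∧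
      ∀ e : geomTorsion W (p : ℤ) ≃+ geomTorsion W₁ (p : ℤ),
        (∀ (σ : absoluteGaloisGroup ℚ) (P : geomTorsion W (p : ℤ)), e (σ • P) = σ • e P) →
        ∀ P : geomTorsion W (p : ℤ),
          AddSubgroup.inclusion (geomTorsion_le_geomPrimaryTorsion W p) P ∈ L.plus ↔
            AddSubgroup.inclusion (geomTorsion_le_geomPrimaryTorsion W₁ p) (e P) ∈ L₁.plus := by
  obtain ⟨V, _, _, C, hV, hC⟩ := hpm.exists_mult_pStar_twist_model hp2
  obtain ⟨V₁, _, _, C₁, hV₁, hC₁⟩ := hpm₁.exists_mult_pStar_twist_model hp2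
  obtain ⟨K, _, _, hK2, θ, hθ, hθ2⟩ := RamifiedOrdinaryLinePotMult.exists_numberField_sq_eq_pStar hp2
  exact exists_lines_matching_of_mult_twists V V₁ K hK2 hθ hθ2 p hC hC₁ hT40 hT41 hp2 hV hV₁ hv
    (RamifiedOrdinaryLinePotMult.valuation_pStar p v hv)

end Classes

end Summit.BirchSwinnertonDyer.Rank1Residual.AdditivePotMult

end
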